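import Mathlib.Algebra.Group.Subgroup.Lattice
import Mathlib.Algebra.Group.Pi.Basic
import Mathlib.Algebra.Group.Pointwise.Set.Basic
import Mathlib.Algebra.Module.Equiv.Basic
import Mathlib.Tactic.Group
import Summits.ABC.IUTFork.Thm311Multirad

/-!
# [IUTchIII] Theorem 3.11 (i): the group structure of (Ind1), (Ind2) — proofs over `Thm311Sig`

PROOF-ONLY companion (no new definitions, no new signatures) to seat abc-iut-c312-1's record-only files
`Thm311Sig` (A: `Ind1`, `Ind2` as explicit SETS of linear automorphisms of the tensor packets) and
`Thm311Multirad` (B: the families `Ind1Family`, `Ind2Family`) of the abc-iut cell; TAKES NO SIDE.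
Written by the wave-2 support seat abc-iut-L6-t13 (plan/WAVE2-SLICES.tsv row 63).

The signature `LogShells` of file A records about the two sets of automorphisms it lets act — the
strip-automorphisms `stripAut v` ("induced by isomorphisms of `D⊢`-prime-strips", Prop. 1.2 (vi)
functoriality) and `ism v` ("Ism", resp. the sign automorphisms) — ONLY that they contain the identity.
Downstream, [IUTchIII] Cor. 3.12 takes "the union of the possible images of a Θ-pilot object … subject to
the indeterminacies (Ind1), (Ind2), (Ind3)", typed by abc-iut-c312-1 (file G `Thm311Pilot`) as the orbit
under the SUBGROUP `IndGroup := Subgroup.closure (Ind1Family ∪ Ind2Family)`, and Dupuy–Hilado §4.11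
print the same region as `U_Θ := Ind2(Ind1((O_𝕃(−P_Θ))^{Ind3}))` — generators applied ONCE, in a fixed
order ("The order of operations … is intentional and correct", §1 p. 3). This file proves, in the kernel,
what reconciles the two and under exactly which hypotheses on the instantiated signature:

1. ALGEBRA of the three constructors of file A inside Mathlib's automorphism groups
   (`LinearEquiv.automorphismGroup`, `f * g = g.trans f`): `summandwise`, `factorwise` (=
   `PiTensorProduct.congr`) and `permute` (= `PiTensorProduct.reindex`) are multiplicative and commute
   with inverses, and THE COMMUTATION RULE `permute σ * factorwise e = factorwise (e ∘ σ⁻¹) * permute σ`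
   (Mathlib's `PiTensorProduct.map_comp_reindex_eq`): conjugating a factorwise automorphism by a
   permutation of the capsule indices re-indexes it (Dupuy–Hilado §4.7 "simultaneous" action).
2. Under the hypotheses an instantiation is expected to prove — (HS) `stripAut v` and (HI) `ism v` are
   closed under composition and inverse, (HN) `stripAut v` normalises `ism v` — the sets `Ind2 j v_ℚ`,
   `Ind1 j`, `Ind2Family`, `Ind1Family` are closed under composition and inverse, and (Ind1)
   NORMALISES (Ind2) (`conj_mem_Ind2Family`).
3. Hence `closure_eq_Ind2Family_mul_Ind1Family` / `closure_eq_Ind1Family_mul_Ind2Family`: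
   `(IndGroup : Set) = Ind2Family * Ind1Family = Ind1Family * Ind2Family` (pointwise products): every
   indeterminacy of the generated group is ONE (Ind1)-family followed by ONE (Ind2)-family — the
   author's-terms counterpart of Dupuy–Hilado's "Ind2(Ind1(−))" — and THIS FILE PROVES that under
   (HI)(HS)(HN) the order of the two kinds does not matter for the generated group (Dupuy–Hilado only
   remark that their order "is intentional and correct", §1 p. 3; order-independence is not their
   claim); and `image_closure_eq`: the orbit of a region under the generated group is
   `{Φ₂ '' (Φ₁ '' R)}`.

Sources read on the page: [IUTchIII] kurims pp. 153–155 (Thm. 3.11 (i), (Ind1), (Ind2)); [IUTchI] p. 33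
(§0 capsule-full poly-isomorphisms); Dupuy–Hilado arXiv:2004.13228 §1 p. 3, §4.7, §4.9, §4.11.
[claim: Mochizuki2012, status: disputed] for the quoted statement; [cite: DupuyHilado2025, §4.7–4.11];
every theorem below is [folklore] (group bookkeeping) and assumes nothing about Theorem 3.11.
Deliberately NOT here: any instance/definition; whether (HS)/(HI)/(HN) hold for the real log-shells
(campaign M: abc-iut-L6-t3 [IUTchIII] Prop. 1.2 (vi)(vii), abc-iut-L4-t3 [AbsTopIII] Prop. 5.8,
abc-iut-L6-t1 [IUTchII] Ex. 1.8 (iv) "Ism"); log-volumes; any judgement.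
-/

open scoped Pointwise TensorProduct

namespace Summit.ABC

namespace IUTFork

namespace Thm311

variable {T : ThetaIndex} (L : LogShells T)

namespace LogShells

/-! ## 1. Algebra of `summandwise`, `factorwise`, `permute` -/

/-- `summandwise` is multiplicative (pointwise composition on the summands). [folklore] -/
theorem summandwise_mul (vQ : T.VQ) (g g' : ∀ v : T.Fibre vQ, L.carrier v.1 ≃ₗ[ℚ] L.carrier v.1) :
    L.summandwise vQ (g * g') = L.summandwise vQ g * L.summandwise vQ g' := rfl

/-- `summandwise` of the identity family is the identity. [folklore] -/
theorem summandwise_one (vQ : T.VQ) : L.summandwise vQ 1 = (1 : L.Packet1 vQ ≃ₗ[ℚ] L.Packet1 vQ) := rfl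

/-- `summandwise` commutes with inverses. [folklore] -/
theorem summandwise_inv (vQ : T.VQ) (g : ∀ v : T.Fibre vQ, L.carrier v.1 ≃ₗ[ℚ] L.carrier v.1) :
    L.summandwise vQ g⁻¹ = (L.summandwise vQ g)⁻¹ := rfl

/-- `factorwise` (= `PiTensorProduct.congr`) is multiplicative. [folklore] -/
theorem factorwise_mul (j : T.Label) (vQ : T.VQ) (e e' : T.Caps j → (L.Packet1 vQ ≃ₗ[ℚ] L.Packet1 vQ)) :
    L.factorwise j vQ (e * e') = L.factorwise j vQ e * L.factorwise j vQ e' := by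
  apply LinearEquiv.toLinearMap_injective
  rw [LinearEquiv.coe_toLinearMap_mul]
  change PiTensorProduct.map (fun i => ((e * e') i : L.Packet1 vQ →ₗ[ℚ] L.Packet1 vQ)) =
    PiTensorProduct.map (fun i => (e i : L.Packet1 vQ →ₗ[ℚ] L.Packet1 vQ)) *
      PiTensorProduct.map (fun i => (e' i : L.Packet1 vQ →ₗ[ℚ] L.Packet1 vQ))
  rw [← PiTensorProduct.map_mul]
  rfl

/-- `factorwise` of the identity family is the identity. [folklore] -/
theorem factorwise_one (j : T.Label) (vQ : T.VQ) :
    L.factorwise j vQ 1 = (1 : L.Packet j vQ ≃ₗ[ℚ] L.Packet j vQ) :=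
  L.factorwise_refl j vQ

/-- `factorwise` commutes with inverses. [folklore] -/
theorem factorwise_inv (j : T.Label) (vQ : T.VQ) (e : T.Caps j → (L.Packet1 vQ ≃ₗ[ℚ] L.Packet1 vQ)) :
    L.factorwise j vQ e⁻¹ = (L.factorwise j vQ e)⁻¹ := by
  apply eq_inv_of_mul_eq_one_left
  rw [← factorwise_mul, inv_mul_cancel, factorwise_one]

/-- `permute` (= `PiTensorProduct.reindex`) is multiplicative: `σ * τ` (first `τ`, then `σ`) permutes
the tensor factors by `τ` then by `σ`. [folklore] -/
theorem permute_mul (j : T.Label) (vQ : T.VQ) (σ τ : Equiv.Perm (T.Caps j)) :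
    L.permute j vQ (σ * τ) = L.permute j vQ σ * L.permute j vQ τ := by
  rw [LinearEquiv.mul_eq_trans, Equiv.Perm.mul_def]
  exact (PiTensorProduct.reindex_trans τ σ).symm

/-- `permute` commutes with inverses. [folklore] -/
theorem permute_inv (j : T.Label) (vQ : T.VQ) (σ : Equiv.Perm (T.Caps j)) :
    L.permute j vQ σ⁻¹ = (L.permute j vQ σ)⁻¹ := by
  apply eq_inv_of_mul_eq_one_left
  rw [← permute_mul, inv_mul_cancel]
  exact L.permute_refl j vQ

/-- **Commutation rule** (Dupuy–Hilado §4.7: the permutation acts "simultaneously" on the factors):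
permuting the tensor factors after a factorwise automorphism is the re-indexed factorwise automorphism
after permuting, `σ ∘ (⊗_i e_i) = (⊗_i e_{σ⁻¹ i}) ∘ σ`. [folklore] -/
theorem permute_mul_factorwise (j : T.Label) (vQ : T.VQ) (σ : Equiv.Perm (T.Caps j))
    (e : T.Caps j → (L.Packet1 vQ ≃ₗ[ℚ] L.Packet1 vQ)) :
    L.permute j vQ σ * L.factorwise j vQ e = L.factorwise j vQ (fun i => e (σ⁻¹ i)) * L.permute j vQ σ := by
  apply LinearEquiv.toLinearMap_injective
  rw [LinearEquiv.coe_toLinearMap_mul, LinearEquiv.coe_toLinearMap_mul]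
  exact (PiTensorProduct.map_comp_reindex_eq (fun i => (e i : L.Packet1 vQ →ₗ[ℚ] L.Packet1 vQ)) σ).symm

/-- Conjugating a factorwise automorphism by a permutation of the capsule indices re-indexes it.
[folklore] -/
theorem permute_mul_factorwise_mul_inv (j : T.Label) (vQ : T.VQ) (σ : Equiv.Perm (T.Caps j))
    (e : T.Caps j → (L.Packet1 vQ ≃ₗ[ℚ] L.Packet1 vQ)) :
    L.permute j vQ σ * L.factorwise j vQ e * (L.permute j vQ σ)⁻¹ =
      L.factorwise j vQ (fun i => e (σ⁻¹ i)) := by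
  rw [permute_mul_factorwise, mul_inv_cancel_right]

/-- The same rule read from the other side: `(⊗_i e_i) ∘ σ = σ ∘ (⊗_i e_{σ i})`. [folklore] -/
theorem factorwise_mul_permute (j : T.Label) (vQ : T.VQ) (σ : Equiv.Perm (T.Caps j))
    (e : T.Caps j → (L.Packet1 vQ ≃ₗ[ℚ] L.Packet1 vQ)) :
    L.factorwise j vQ e * L.permute j vQ σ = L.permute j vQ σ * L.factorwise j vQ (fun i => e (σ i)) := by
  rw [permute_mul_factorwise]
  congr 2
  funext i
  simp

/-! ## 2. (Ind2) and (Ind1) are closed under composition and inverse; (Ind1) normalises (Ind2)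

Hypotheses, named once and for all (each an explicit argument, never assumed globally):
(HI) `ism v` closed under `*` and `⁻¹`; (HS) `stripAut v` closed under `*` and `⁻¹`;
(HN) `stripAut v` normalises `ism v`. -/

section Ind2

variable {L}
variable (hI : ∀ v, ∀ a ∈ L.ism v, ∀ b ∈ L.ism v, a * b ∈ L.ism v)
variable (hI' : ∀ v, ∀ a ∈ L.ism v, a⁻¹ ∈ L.ism v)

/-- The identity is in (Ind2) (file A's `refl_mem_Ind2`, in group notation). [folklore] -/
theorem one_mem_Ind2 (j : T.Label) (vQ : T.VQ) : (1 : L.Packet j vQ ≃ₗ[ℚ] L.Packet j vQ) ∈ L.Ind2 j vQ :=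
  L.refl_mem_Ind2 j vQ

include hI in
/-- (HI) ⇒ (Ind2) at `(j, v_ℚ)` is closed under composition: acting by `g` then by `g'` on each summand
of each factor is acting by `g' * g`. [folklore] -/
theorem mul_mem_Ind2 {j : T.Label} {vQ : T.VQ} {φ ψ : L.Packet j vQ ≃ₗ[ℚ] L.Packet j vQ}
    (hφ : φ ∈ L.Ind2 j vQ) (hψ : ψ ∈ L.Ind2 j vQ) : φ * ψ ∈ L.Ind2 j vQ := by
  obtain ⟨g, hg, rfl⟩ := hφ
  obtain ⟨g', hg', rfl⟩ := hψ
  refine ⟨g * g', fun i v => hI _ _ (hg i v) _ (hg' i v), ?_⟩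
  rw [← factorwise_mul]
  rfl

include hI' in
/-- (HI) ⇒ (Ind2) at `(j, v_ℚ)` is closed under inverse. [folklore] -/
theorem inv_mem_Ind2 {j : T.Label} {vQ : T.VQ} {φ : L.Packet j vQ ≃ₗ[ℚ] L.Packet j vQ}
    (hφ : φ ∈ L.Ind2 j vQ) : φ⁻¹ ∈ L.Ind2 j vQ := by
  obtain ⟨g, hg, rfl⟩ := hφ
  refine ⟨g⁻¹, fun i v => hI' _ _ (hg i v), ?_⟩
  rw [← factorwise_inv]
  rfl

include hI in
/-- (HI) ⇒ the (Ind2)-FAMILIES are closed under composition. [folklore] -/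
theorem mul_mem_Ind2Family {Φ Ψ : L.PacketAut} (hΦ : Φ ∈ L.Ind2Family) (hΨ : Ψ ∈ L.Ind2Family) :
    Φ * Ψ ∈ L.Ind2Family :=
  fun j vQ => mul_mem_Ind2 hI (hΦ j vQ) (hΨ j vQ)

include hI' in
/-- (HI) ⇒ the (Ind2)-families are closed under inverse. [folklore] -/
theorem inv_mem_Ind2Family {Φ : L.PacketAut} (hΦ : Φ ∈ L.Ind2Family) : Φ⁻¹ ∈ L.Ind2Family :=
  fun j vQ => inv_mem_Ind2 hI' (hΦ j vQ)

/-- The identity family is an (Ind2)-family (file B's `refl_mem_Ind2Family`, in group notation).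
[folklore] -/
theorem one_mem_Ind2Family : (1 : L.PacketAut) ∈ L.Ind2Family := MRData.refl_mem_Ind2Family

end Ind2

section Ind1

variable {L}
variable (hS : ∀ v, ∀ a ∈ L.stripAut v, ∀ b ∈ L.stripAut v, a * b ∈ L.stripAut v)
variable (hS' : ∀ v, ∀ a ∈ L.stripAut v, a⁻¹ ∈ L.stripAut v)
variable (hN : ∀ v, ∀ a ∈ L.stripAut v, ∀ g ∈ L.ism v, a * g * a⁻¹ ∈ L.ism v)

/-- An element of (Ind1) at label `j`, in group notation: at every `v_ℚ` it is
`(⊗_i ⊕_v h_{i,v}) * σ` — the permutation `σ` of the capsule indices FIRST, then the strip-automorphisms.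
[folklore] -/
theorem mem_Ind1_iff {j : T.Label} (Φ : ∀ vQ : T.VQ, L.Packet j vQ ≃ₗ[ℚ] L.Packet j vQ) :
    Φ ∈ L.Ind1 j ↔ ∃ (σ : Equiv.Perm (T.Caps j)) (h : T.Caps j → ∀ v : T.V, L.carrier v ≃ₗ[ℚ] L.carrier v),
      (∀ i v, h i v ∈ L.stripAut v) ∧
      ∀ vQ, Φ vQ = (L.factorwise j vQ fun i => L.summandwise vQ fun v => h i v.1) * L.permute j vQ σ :=
  Iff.rfl

/-- The identity is in (Ind1) (file A's `refl_mem_Ind1`, in group notation). [folklore] -/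
theorem one_mem_Ind1 (j : T.Label) : (1 : ∀ vQ : T.VQ, L.Packet j vQ ≃ₗ[ℚ] L.Packet j vQ) ∈ L.Ind1 j :=
  L.refl_mem_Ind1 j

include hS in
/-- (HS) ⇒ (Ind1) at label `j` is closed under composition: `(H * σ) * (H' * σ') = (H * H'^{σ}) * (σσ')`
with `H'^{σ} = σ H' σ⁻¹` again factorwise-summandwise, by the commutation rule. [folklore] -/
theorem mul_mem_Ind1 {j : T.Label} {Φ Ψ : ∀ vQ : T.VQ, L.Packet j vQ ≃ₗ[ℚ] L.Packet j vQ}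
    (hΦ : Φ ∈ L.Ind1 j) (hΨ : Ψ ∈ L.Ind1 j) : Φ * Ψ ∈ L.Ind1 j := by
  obtain ⟨σ, h, hh, hΦ⟩ := hΦ
  obtain ⟨σ', h', hh', hΨ⟩ := hΨ
  refine ⟨σ * σ', fun i v => h i v * h' (σ⁻¹ i) v, fun i v => hS _ _ (hh i v) _ (hh' _ v), fun vQ => ?_⟩
  rw [Pi.mul_apply, hΦ vQ, hΨ vQ, ← LinearEquiv.mul_eq_trans, ← LinearEquiv.mul_eq_trans,
    ← LinearEquiv.mul_eq_trans, mul_assoc, ← mul_assoc (L.permute j vQ σ), permute_mul_factorwise,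
    mul_assoc, ← permute_mul, ← mul_assoc, ← factorwise_mul]
  rfl

include hS' in
/-- (HS) ⇒ (Ind1) at label `j` is closed under inverse: `(H * σ)⁻¹ = (σ⁻¹ H⁻¹ σ) * σ⁻¹`. [folklore] -/
theorem inv_mem_Ind1 {j : T.Label} {Φ : ∀ vQ : T.VQ, L.Packet j vQ ≃ₗ[ℚ] L.Packet j vQ}
    (hΦ : Φ ∈ L.Ind1 j) : Φ⁻¹ ∈ L.Ind1 j := by
  obtain ⟨σ, h, hh, hΦ⟩ := hΦ
  refine ⟨σ⁻¹, fun i v => (h (σ i) v)⁻¹, fun i v => hS' _ _ (hh _ v), fun vQ => ?_⟩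
  rw [Pi.inv_apply, hΦ vQ, ← LinearEquiv.mul_eq_trans, ← LinearEquiv.mul_eq_trans, mul_inv_rev,
    ← permute_inv, ← factorwise_inv, permute_mul_factorwise, inv_inv]
  rfl

include hS in
/-- (HS) ⇒ the (Ind1)-FAMILIES are closed under composition. [folklore] -/
theorem mul_mem_Ind1Family {Φ Ψ : L.PacketAut} (hΦ : Φ ∈ L.Ind1Family) (hΨ : Ψ ∈ L.Ind1Family) :
    Φ * Ψ ∈ L.Ind1Family :=
  fun j => mul_mem_Ind1 hS (hΦ j) (hΨ j)

include hS' in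
/-- (HS) ⇒ the (Ind1)-families are closed under inverse. [folklore] -/
theorem inv_mem_Ind1Family {Φ : L.PacketAut} (hΦ : Φ ∈ L.Ind1Family) : Φ⁻¹ ∈ L.Ind1Family :=
  fun j => inv_mem_Ind1 hS' (hΦ j)

/-- The identity family is an (Ind1)-family (file B's `refl_mem_Ind1Family`, in group notation).
[folklore] -/
theorem one_mem_Ind1Family : (1 : L.PacketAut) ∈ L.Ind1Family := MRData.refl_mem_Ind1Family

include hN in
/-- (HN) ⇒ **(Ind1) normalises (Ind2)**: conjugating "independent copies of Ism on each summand of each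
factor" by a procession automorphism `(⊗_i ⊕_v h_{i,v}) * σ` gives independent copies of Ism again
(re-indexed by `σ`, conjugated summand-wise by the strip-automorphisms). [folklore] -/
theorem conj_mem_Ind2 {j : T.Label} {Φ : ∀ vQ : T.VQ, L.Packet j vQ ≃ₗ[ℚ] L.Packet j vQ}
    (hΦ : Φ ∈ L.Ind1 j) {vQ : T.VQ} {ψ : L.Packet j vQ ≃ₗ[ℚ] L.Packet j vQ} (hψ : ψ ∈ L.Ind2 j vQ) :
    Φ vQ * ψ * (Φ vQ)⁻¹ ∈ L.Ind2 j vQ := by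
  obtain ⟨σ, h, hh, hΦ⟩ := hΦ
  obtain ⟨g, hg, rfl⟩ := hψ
  refine ⟨fun i v => h i v.1 * g (σ⁻¹ i) v * (h i v.1)⁻¹,
    fun i v => hN _ _ (hh i v.1) _ (hg _ v), ?_⟩
  rw [hΦ vQ, ← LinearEquiv.mul_eq_trans, mul_inv_rev,
    show ∀ F P G : L.Packet j vQ ≃ₗ[ℚ] L.Packet j vQ, F * P * G * (P⁻¹ * F⁻¹) = F * (P * G * P⁻¹) * F⁻¹
      from fun F P G => by group,
    permute_mul_factorwise_mul_inv, ← factorwise_inv, ← factorwise_mul, ← factorwise_mul]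
  rfl

include hN in
/-- (HN) ⇒ the (Ind1)-families normalise the (Ind2)-families. [folklore] -/
theorem conj_mem_Ind2Family {Φ Ψ : L.PacketAut} (hΦ : Φ ∈ L.Ind1Family) (hΨ : Ψ ∈ L.Ind2Family) :
    Φ * Ψ * Φ⁻¹ ∈ L.Ind2Family :=
  fun j vQ => conj_mem_Ind2 hN (hΦ j) (hΨ j vQ)

/-! ## 3. The generated group is `(Ind2)·(Ind1)` = `(Ind1)·(Ind2)` -/

include hS hS' hN in
/-- **Product decomposition.** Under (HI), (HS), (HN), the subgroup of packet-automorphism families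
generated by the (Ind1)- and (Ind2)-families (abc-iut-c312-1's `IndGroup`, file G) is, as a set, the
pointwise product `Ind2Family * Ind1Family`: every indeterminacy is ONE (Ind1)-family followed by ONE
(Ind2)-family — the author's-terms form of Dupuy–Hilado's `U_Θ := Ind2(Ind1(−))` (§4.11).
[folklore] -/
theorem closure_eq_Ind2Family_mul_Ind1Family
    (hI : ∀ v, ∀ a ∈ L.ism v, ∀ b ∈ L.ism v, a * b ∈ L.ism v) (hI' : ∀ v, ∀ a ∈ L.ism v, a⁻¹ ∈ L.ism v) :
    (Subgroup.closure (L.Ind1Family ∪ L.Ind2Family) : Set L.PacketAut) = L.Ind2Family * L.Ind1Family := by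
  -- the product set is a subgroup containing the generators
  let M : Subgroup L.PacketAut :=
    { carrier := L.Ind2Family * L.Ind1Family
      one_mem' := Set.mem_mul.2 ⟨1, one_mem_Ind2Family, 1, one_mem_Ind1Family, mul_one 1⟩
      mul_mem' := by
        rintro _ _ ⟨a₂, ha₂, a₁, ha₁, rfl⟩ ⟨b₂, hb₂, b₁, hb₁, rfl⟩
        refine Set.mem_mul.2 ⟨a₂ * (a₁ * b₂ * a₁⁻¹), mul_mem_Ind2Family hI ha₂ (conj_mem_Ind2Family hN ha₁ hb₂),
          a₁ * b₁, mul_mem_Ind1Family hS ha₁ hb₁, by group⟩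
      inv_mem' := by
        rintro _ ⟨a₂, ha₂, a₁, ha₁, rfl⟩
        refine Set.mem_mul.2 ⟨a₁⁻¹ * a₂⁻¹ * a₁⁻¹⁻¹,
          conj_mem_Ind2Family hN (inv_mem_Ind1Family hS' ha₁) (inv_mem_Ind2Family hI' ha₂),
          a₁⁻¹, inv_mem_Ind1Family hS' ha₁, by group⟩ }
  apply le_antisymm
  · change (Subgroup.closure (L.Ind1Family ∪ L.Ind2Family) : Set L.PacketAut) ≤ (M : Set L.PacketAut)
    exact SetLike.coe_subset_coe.2 ((Subgroup.closure_le M).2 (by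
      rintro Φ (hΦ | hΦ)
      · exact Set.mem_mul.2 ⟨1, one_mem_Ind2Family, Φ, hΦ, one_mul Φ⟩
      · exact Set.mem_mul.2 ⟨Φ, hΦ, 1, one_mem_Ind1Family, mul_one Φ⟩))
  · rintro _ ⟨a₂, ha₂, a₁, ha₁, rfl⟩
    exact mul_mem (Subgroup.subset_closure (Or.inr ha₂)) (Subgroup.subset_closure (Or.inl ha₁))

include hS hS' hN in
/-- … and also `Ind1Family * Ind2Family`: PROVED HERE (not a printed claim) — under (HI), (HS), (HN) the
order of the two kinds of indeterminacy does not matter for the generated group, so both orders give the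
same family of possible images. (Dupuy–Hilado §1 p. 3 only state that their order "is intentional and
correct".) [folklore] -/
theorem closure_eq_Ind1Family_mul_Ind2Family
    (hI : ∀ v, ∀ a ∈ L.ism v, ∀ b ∈ L.ism v, a * b ∈ L.ism v) (hI' : ∀ v, ∀ a ∈ L.ism v, a⁻¹ ∈ L.ism v) :
    (Subgroup.closure (L.Ind1Family ∪ L.Ind2Family) : Set L.PacketAut) = L.Ind1Family * L.Ind2Family := by
  let M : Subgroup L.PacketAut :=
    { carrier := L.Ind1Family * L.Ind2Family
      one_mem' := Set.mem_mul.2 ⟨1, one_mem_Ind1Family, 1, one_mem_Ind2Family, mul_one 1⟩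
      mul_mem' := by
        rintro _ _ ⟨a₁, ha₁, a₂, ha₂, rfl⟩ ⟨b₁, hb₁, b₂, hb₂, rfl⟩
        refine Set.mem_mul.2 ⟨a₁ * b₁, mul_mem_Ind1Family hS ha₁ hb₁,
          b₁⁻¹ * a₂ * b₁⁻¹⁻¹ * b₂,
          mul_mem_Ind2Family hI (conj_mem_Ind2Family hN (inv_mem_Ind1Family hS' hb₁) ha₂) hb₂, by group⟩
      inv_mem' := by
        rintro _ ⟨a₁, ha₁, a₂, ha₂, rfl⟩
        refine Set.mem_mul.2 ⟨a₁⁻¹, inv_mem_Ind1Family hS' ha₁,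
          a₁ * a₂⁻¹ * a₁⁻¹, conj_mem_Ind2Family hN ha₁ (inv_mem_Ind2Family hI' ha₂), by group⟩ }
  apply le_antisymm
  · change (Subgroup.closure (L.Ind1Family ∪ L.Ind2Family) : Set L.PacketAut) ≤ (M : Set L.PacketAut)
    exact SetLike.coe_subset_coe.2 ((Subgroup.closure_le M).2 (by
      rintro Φ (hΦ | hΦ)
      · exact Set.mem_mul.2 ⟨Φ, hΦ, 1, one_mem_Ind2Family, mul_one Φ⟩
      · exact Set.mem_mul.2 ⟨1, one_mem_Ind1Family, Φ, hΦ, one_mul Φ⟩))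
  · rintro _ ⟨a₁, ha₁, a₂, ha₂, rfl⟩
    exact mul_mem (Subgroup.subset_closure (Or.inl ha₁)) (Subgroup.subset_closure (Or.inr ha₂))

include hS hS' hN in
/-- **The possible images of a region**, author's terms vs. Dupuy–Hilado: under (HI), (HS), (HN), the
orbit of a region `R ⊆ I^ℚ(^{S^±_{j+1}};D⊢_{v_ℚ})` under the generated group (abc-iut-c312-1's
`possibleImages`, file G: `{Φ '' R | Φ ∈ IndGroup}`) is the family of regions obtained by applying ONE
(Ind1)-family and then ONE (Ind2)-family (`Ind2(Ind1(R))`, Dupuy–Hilado §4.11). [folklore] -/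
theorem image_closure_eq
    (hI : ∀ v, ∀ a ∈ L.ism v, ∀ b ∈ L.ism v, a * b ∈ L.ism v) (hI' : ∀ v, ∀ a ∈ L.ism v, a⁻¹ ∈ L.ism v)
    (j : T.Label) (vQ : T.VQ) (R : Set (L.Packet j vQ)) :
    {A | ∃ Φ ∈ Subgroup.closure (L.Ind1Family ∪ L.Ind2Family), A = Φ j vQ '' R} =
      {A | ∃ Φ₁ ∈ L.Ind1Family, ∃ Φ₂ ∈ L.Ind2Family, A = Φ₂ j vQ '' (Φ₁ j vQ '' R)} := by
  ext A
  simp only [Set.mem_setOf_eq]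
  constructor
  · rintro ⟨Φ, hΦ, rfl⟩
    have hΦ' : Φ ∈ (Subgroup.closure (L.Ind1Family ∪ L.Ind2Family) : Set L.PacketAut) := hΦ
    rw [closure_eq_Ind2Family_mul_Ind1Family hS hS' hN hI hI'] at hΦ'
    obtain ⟨Φ₂, h₂, Φ₁, h₁, rfl⟩ := hΦ'
    refine ⟨Φ₁, h₁, Φ₂, h₂, ?_⟩
    rw [Set.image_image]; rfl
  · rintro ⟨Φ₁, h₁, Φ₂, h₂, rfl⟩
    refine ⟨Φ₂ * Φ₁, mul_mem (Subgroup.subset_closure (Or.inr h₂)) (Subgroup.subset_closure (Or.inl h₁)),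
      ?_⟩
    rw [Set.image_image]; rfl

end Ind1

end LogShells

end Thm311

end IUTFork

end Summit.ABC
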